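import Summits.RiemannHypothesis.RiemannHypothesis.Theorems.Splittings.LiCriterionResidueClassesBLPrelims
import HarnessLib

/-!
# Li's criterion along RESIDUE CLASSES `n ≡ t (mod q)` with a verified height as load-bearing input — part 2/3:
# Bombieri–Lagarias (c)⇒(a) with a CONSTRAINED exponent (recurrence along multiples of `qL`, then a shift by `s = |t|`)

**New kernel statement.**  Let `H ≥ 1` be a verified height (`RiemannHypothesisUpTo H`: every zero with
`0 < Im ρ ≤ H` is on the line), `q ≥ 1` a modulus and `t ∈ ℤ` a shift with `|t| < (π/2)(H − 1/4)`.  Then for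
every constant `C`

  `(∀ n ≥ 1, n ≡ t (mod q) → λ_n ≥ −C) → RH`   (`riemannHypothesis_of_keiperLiCoeff_bddBelow_modEq`),

hence `RH ↔ (λ_n)_{n ≡ t (q)}` bounded below `↔` nonneg `↔` any slack co-finite tail of the class.  With the tree's
KERNEL-checked `riemannHypothesisUpTo_1000` this is unconditional for all `|t| ≤ 1570`, i.e. for EVERY residue
class of EVERY modulus `q ≤ 3141` (`riemannHypothesis_iff_keiperLiCoeff_bddBelow_mod_of_le`).  g2 proved the
class `t = 0` (`LiCriterionProgressionsBL`, no height needed) and showed that NO class `t ≢ 0` can be decided at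
the level of Bombieri–Lagarias multisets (witness `1 − 1/ρ = ± i r`); the arithmetic input that rescues `ζ` is
exactly a zero-free height, entering LINEARLY: height `H` buys the shifts `|t| < (π/2)(H − 1/4)`.

PROOF (Bombieri–Lagarias' Theorem 1 (c)⇒(a) with a constrained recurrence).  In BL's proof the exponent `n` is
produced by simultaneous recurrence of the finitely many dominant `w_i/λ` (`|w_i| = λ` maximal); we run the
recurrence along multiples of `qL` (Bolzano–Weierstrass for `k ↦ (z_i^{kqL})_i`) with accuracy `ε`, and then
shift by `s = |t|`: `n = d·qL ± s ≡ t (mod q)`, `Re (z_i^n) ≥ Re(z_i^{±s}) − ε`.  So what is needed is a uniform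
PHASE CONDITION at exponent `s` on the off-line zeros: `Re(w^s) ≥ c₀ |w|^s`, `c₀ > 0`.  For `ζ`, an off-line zero
`ρ = β + iγ` has `|γ| > H` under `RiemannHypothesisUpTo H` (conjugation symmetry for `γ < 0`), and for
`z = 1 − 1/ρ`: `|arg z| ≤ |Im z|/Re z ≤ 1/(|γ| − 1/4)`, so `s·|arg z| ≤ s/(H − 1/4) =: Θ₀ < π/2` and
`Re(z^s) = |z|^s cos(s arg z) ≥ |z|^s cos Θ₀`.  SHARP at multiset level: a conjugate pair with
`arg(1 − 1/ρ) = ± π/(2s)` (so `s·θ = π/2`, `cos = 0`) has ALL its Li sums along `n ≡ s (mod 4s)` equal to `2`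
(`LiResidueBL.sharp_pair_sum`), whatever its modulus `r > 1`.

References: [BombieriLagarias1999] Thm 1; [Li1997]; [Brent1979] (height 1000); Platt–Trudgian 2021 (F1).

This part (2/3) is the engine `LiResidueBL.exists_tsum_lt_of_returns` & co. (generic index type `ι`, multiplicities, summable
Bombieri–Lagarias weight; the elementary helper lemmas are the landed ones of `Splittings/LiIndexSetsPrelims.lean`).

Provenance: cell rh-split, seat rh-split-li-finite g3, raw zero-def file `HOME/rh-split-li-finite/LiCriterionResidueClassesBL.lean`
(sha16 6ac0174b44e3a51a, 977 lines; proofs verbatim), filed in three parts ≤ 400 lines by rh-split-typer-1 g2 (INBOX 22:27Z item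
(6c)): `…BLPrelims` (§0 elementary facts not already in `LiIndexSetsPrelims`, §1 recurrence along multiples, §3 the phase of
`1 − 1/ρ`, small facts on the zeros), `…BLEngine` (§2 Bombieri–Lagarias (c)⇒(a) with a constrained exponent), `…BL` (§4 the
theorems for `ζ`).  The Bombieri–Lagarias helper lemmas of the scratch's §0 that coincide verbatim with the landed `Splittings/LiIndexSetsPrelims.lean`
(p468824), and the four small facts shared with `LiCriterionProgressionsBL.lean` (`LiProgressionBL.norm_one_sub_one_div_le_one_iff`,
`coe_ne_zero`, `toNat_order_cast`, `riemannHypothesis_of_forall_half_le_re`), are imported from there, not restated.  Typer-1 g2 replay of the 977-line raw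
file: farm rc 0, 0 warnings, 0 sorry; `#print axioms` = [propext, Classical.choice, Quot.sound] on
`riemannHypothesis_of_keiperLiCoeff_bddBelow_modEq` and `riemannHypothesis_iff_keiperLiCoeff_bddBelow_mod_of_le`; read-back:
`RiemannHypothesisUpTo H` occurs only as a hypothesis binder, the kernel instances cite `riemannHypothesisUpTo_1000` by name.

HONEST LABEL: SPLITTING SEARCH over kernel-typed RH-EQUIVALENCES; a splitting A ∧ B ⟹ RH is CONDITIONAL bookkeeping unless A
and B are both proved; nothing here bears on the truth of RH.
-/

noncomputable section

-- D-0017: `Summit.<S>.<S>.…` is the designed namespace of a single-problem summit.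
set_option linter.dupNamespace false

namespace Summit.RiemannHypothesis.RiemannHypothesis.Theorems.Splittings

open Filter Topology Complex
open scoped ComplexConjugate
open Literature.NumberTheory.LFunctions
open Literature.NumberTheory.LFunctions.BombieriLagarias
open Literature.NumberTheory.LFunctions.ZetaZeros
open Literature.NumberTheory.DiophantineGeometry (RiemannHypothesisUpTo)
open Summit.RiemannHypothesis.RiemannHypothesis.Theorems.Splittings.LiIndexSets
open Summit.RiemannHypothesis.RiemannHypothesis.Theorems.Splittings.LiProgressionBL

namespace LiResidueBL

/-! ## §2 Bombieri–Lagarias (c)⇒(a) with a CONSTRAINED exponent -/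

variable {ι : Type*} {ρ : ι → ℂ} {m : ι → ℕ}

/-- **Bombieri–Lagarias (c)⇒(a), quantitative core with an ABSTRACT RETURN HYPOTHESIS.**  If some `ρ_{i₀}` has
`Re ρ_{i₀} > 1/2` and, for every finite "top set" `B` of common modulus `λ > 1`, exponents `n` with property `P`
and `Re((w_i/λ)^n) ≥ c` on `B` exist beyond every `N` (`c > 0` fixed), then for every `K'` some exponent `n ≥ 1`
WITH PROPERTY `P` has Bombieri–Lagarias sum `< −K'`.  (The tree's `exists_tsum_lt` is the case `P = ⊤`,
`c = 1/2`, the returns supplied by simultaneous recurrence.) -/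
theorem exists_tsum_lt_of_returns (hm : ∀ i, 0 < m i) (h1 : ∀ i, ρ i ≠ 1)
    (hR : Summable (weight ρ m)) {i₀ : ι} (hi₀ : 1 / 2 < (ρ i₀).re) {c : ℝ} (hc : 0 < c)
    (P : ℕ → Prop)
    (hP : ∀ (B : Finset ι) (lam : ℝ), 1 < lam → (∀ i ∈ B, ‖(1 - 1 / ρ i)⁻¹‖ = lam) →
      ∀ N : ℕ, ∃ n : ℕ, N ≤ n ∧ P n ∧ ∀ i ∈ B, c ≤ (((1 - 1 / ρ i)⁻¹ / (lam : ℂ)) ^ n).re)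
    (K' : ℝ) :
    ∃ n : ℕ, 1 ≤ n ∧ P n ∧ ∑' i, (m i : ℝ) * (1 - (1 - 1 / ρ i)⁻¹ ^ n).re < -K' := by
  classical
  set w : ι → ℂ := fun i ↦ (1 - 1 / ρ i)⁻¹ with hw
  set W : ι → ℝ := weight ρ m with hWdef
  set S : ℝ := ∑' i, W i with hSdef
  have hW0 : ∀ i, 0 ≤ W i := weight_nonneg ρ m
  have hS0 : 0 ≤ S := tsum_nonneg hW0
  -- Step 1: level sets `{μ ≤ |w_i|}`, `μ > 1`, are finite
  have hfinlev : ∀ μ : ℝ, 1 < μ → {i | μ ≤ ‖w i‖}.Finite := by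
    intro μ hμ
    refine (finite_norm_le hm hR (max 1 (3 / (μ ^ 2 - 1)) + 1)).subset fun i hi ↦ ?_
    have hb := norm_sub_one_le_of_le_norm hμ (h1 i) hi
    simp only [Set.mem_setOf_eq]
    calc ‖ρ i‖ = ‖(ρ i - 1) + 1‖ := by ring_nf
      _ ≤ ‖ρ i - 1‖ + ‖(1 : ℂ)‖ := norm_add_le _ _
      _ ≤ max 1 (3 / (μ ^ 2 - 1)) + 1 := by rw [norm_one]; linarith
  -- Step 2: the maximal modulus `λ`
  have hl1 : 1 < ‖w i₀‖ := (one_lt_norm_inv_one_sub_inv_iff (h1 i₀)).2 hi₀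
  set A : Finset ι := (hfinlev _ hl1).toFinset with hA
  have hA₀ : i₀ ∈ A := by simp [hA]
  have hAne : A.Nonempty := ⟨i₀, hA₀⟩
  set lam : ℝ := A.sup' hAne (fun i ↦ ‖w i‖) with hlam
  have hlamge : ‖w i₀‖ ≤ lam := Finset.le_sup' (fun i ↦ ‖w i‖) hA₀
  have hlam1 : 1 < lam := hl1.trans_le hlamge
  have hlam0 : 0 < lam := zero_lt_one.trans hlam1
  have hle_lam : ∀ i, ‖w i‖ ≤ lam := by
    intro i
    by_cases hi : i ∈ A
    · exact Finset.le_sup' (fun i ↦ ‖w i‖) hi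
    · have : ¬ ‖w i₀‖ ≤ ‖w i‖ := by simpa [hA] using hi
      exact (le_of_lt (not_le.1 this)).trans hlamge
  -- Step 3: the top set `B` (finite, nonempty) and its mass `MB ≥ 1`
  set B : Finset ι := (hfinlev lam hlam1).toFinset with hB
  have hmemB : ∀ i, i ∈ B ↔ ‖w i‖ = lam := by
    intro i
    simp only [hB, Set.Finite.mem_toFinset, Set.mem_setOf_eq]
    exact ⟨fun h ↦ le_antisymm (hle_lam i) h, fun h ↦ h.ge⟩
  obtain ⟨i₁, hi₁A, hi₁⟩ := Finset.exists_mem_eq_sup' hAne (fun i ↦ ‖w i‖)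
  have hi₁B : i₁ ∈ B := (hmemB i₁).2 hi₁.symm
  set MB : ℝ := ∑ i ∈ B, (m i : ℝ) with hMBdef
  have hMB1 : 1 ≤ MB := by
    calc (1 : ℝ) ≤ m i₁ := by exact_mod_cast hm i₁
      _ ≤ MB := Finset.single_le_sum (f := fun i ↦ (m i : ℝ)) (fun i _ ↦ Nat.cast_nonneg _) hi₁B
  -- Step 4: a uniform gap `|w_i| ≤ ν < λ` off `B`
  set μ : ℝ := (1 + lam) / 2 with hμ
  have hμ1 : 1 < μ := by rw [hμ]; linarith
  have hμlam : μ < lam := by rw [hμ]; linarith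
  set A' : Finset ι := (hfinlev μ hμ1).toFinset with hA'
  set s : Finset ι := A' \ B with hs
  set ν : ℝ := s.fold max μ (fun i ↦ ‖w i‖) with hν
  have hνlam : ν < lam := by
    rw [hν, Finset.fold_max_lt]
    refine ⟨hμlam, fun i hi ↦ lt_of_le_of_ne (hle_lam i) fun h ↦ ?_⟩
    exact (Finset.mem_sdiff.1 hi).2 ((hmemB i).2 h)
  have hμν : μ ≤ ν := by rw [hν, Finset.le_fold_max]; exact Or.inl le_rfl
  have hν0 : 0 ≤ ν := le_trans (by linarith) hμν
  have hoffB : ∀ i, i ∉ B → ‖w i‖ ≤ ν := by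
    intro i hi
    by_cases hi' : i ∈ A'
    · rw [hν, Finset.le_fold_max]
      exact Or.inr ⟨i, Finset.mem_sdiff.2 ⟨hi', hi⟩, le_rfl⟩
    · have : ¬ μ ≤ ‖w i‖ := by simpa [hA'] using hi'
      exact (le_of_lt (not_le.1 this)).trans hμν
  -- Step 5: for large `n` the main term wins: `(MB + |K'| + 27 S n² + 9 S n² νⁿ)/λⁿ < c·MB`
  have hlim : Tendsto (fun n : ℕ ↦ (MB + |K'|) * (1 / lam) ^ n + 27 * S * ((n : ℝ) ^ 2 * (1 / lam) ^ n)
      + 9 * S * ((n : ℝ) ^ 2 * (ν / lam) ^ n)) atTop (𝓝 0) := by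
    have hq1 : |1 / lam| < 1 := by
      rw [abs_of_pos (by positivity), div_lt_one hlam0]; exact hlam1
    have hq2 : |ν / lam| < 1 := by
      rw [abs_of_nonneg (by positivity), div_lt_one hlam0]; exact hνlam
    have t1 : Tendsto (fun n : ℕ ↦ (1 / lam) ^ n) atTop (𝓝 0) := by
      simpa using tendsto_pow_const_mul_const_pow_of_abs_lt_one 0 hq1
    have t2 := tendsto_pow_const_mul_const_pow_of_abs_lt_one 2 hq1
    have t3 := tendsto_pow_const_mul_const_pow_of_abs_lt_one 2 hq2
    have := (t1.const_mul (MB + |K'|)).add ((t2.const_mul (27 * S)).add (t3.const_mul (9 * S)))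
    simpa [add_assoc] using this
  have hcMB : (0 : ℝ) < c * MB := mul_pos hc (by linarith)
  obtain ⟨N₀, hN₀⟩ := eventually_atTop.1 (hlim.eventually_lt_const hcMB)
  -- Step 6: a return with property `P` on `B`
  obtain ⟨n, hnN, hPn, hcos⟩ := hP B lam hlam1 (fun i hi ↦ (hmemB i).1 hi) (max N₀ 1)
  have hn1 : 1 ≤ n := (le_max_right _ _).trans hnN
  have hnN₀ : N₀ ≤ n := (le_max_left _ _).trans hnN
  have hn1' : (1 : ℝ) ≤ n := by exact_mod_cast hn1
  have hnum : MB + |K'| + 27 * S * (n : ℝ) ^ 2 + 9 * S * (n : ℝ) ^ 2 * ν ^ n < c * MB * lam ^ n := by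
    have h := hN₀ n hnN₀
    have hlampow : 0 < lam ^ n := pow_pos hlam0 n
    have e : (MB + |K'|) * (1 / lam) ^ n + 27 * S * ((n : ℝ) ^ 2 * (1 / lam) ^ n)
        + 9 * S * ((n : ℝ) ^ 2 * (ν / lam) ^ n)
        = (MB + |K'| + 27 * S * (n : ℝ) ^ 2 + 9 * S * (n : ℝ) ^ 2 * ν ^ n) / lam ^ n := by
      rw [div_pow, div_pow, one_pow]
      field_simp
    rw [e, div_lt_iff₀ hlampow] at h
    exact h
  refine ⟨n, hn1, hPn, ?_⟩
  -- Step 7: termwise majorant `g`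
  set K : ℝ := 9 * (n : ℝ) ^ 2 * (1 + ν ^ n) + 18 * (n : ℝ) ^ 2 with hK
  have hνn : 0 ≤ ν ^ n := pow_nonneg hν0 n
  have hK0 : 0 ≤ K := by positivity
  have hK18 : 18 * (n : ℝ) ^ 2 ≤ K := by
    rw [hK]; nlinarith [sq_nonneg (n : ℝ)]
  have hK9 : 9 * (n : ℝ) ^ 2 * (1 + ν ^ n) ≤ K := by
    rw [hK]; nlinarith [sq_nonneg (n : ℝ)]
  set f : ι → ℝ := fun i ↦ (m i : ℝ) * (1 - (1 - 1 / ρ i)⁻¹ ^ n).re with hf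
  set g : ι → ℝ := fun i ↦ if i ∈ B then (m i : ℝ) * (1 - c * lam ^ n) else K * W i with hg
  have hfg : ∀ i, f i ≤ g i := by
    intro i
    have hm0 : (0 : ℝ) ≤ m i := Nat.cast_nonneg _
    by_cases hiB : i ∈ B
    · simp only [hf, hg, if_pos hiB]
      have hci : c ≤ (((1 - 1 / ρ i)⁻¹ / (lam : ℂ)) ^ n).re := hcos i hiB
      have hpow : (1 - 1 / ρ i)⁻¹ ^ n = ((lam ^ n : ℝ) : ℂ) * ((1 - 1 / ρ i)⁻¹ / (lam : ℂ)) ^ n := by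
        rw [Complex.ofReal_pow, ← mul_pow, mul_div_cancel₀ _ (Complex.ofReal_ne_zero.2 hlam0.ne')]
      have hre : ((1 - 1 / ρ i)⁻¹ ^ n).re = lam ^ n * (((1 - 1 / ρ i)⁻¹ / (lam : ℂ)) ^ n).re := by
        rw [hpow, Complex.re_ofReal_mul]
      rw [sub_re, one_re, hre]
      refine mul_le_mul_of_nonneg_left ?_ hm0
      nlinarith [pow_pos hlam0 n]
    · simp only [hf, hg, if_neg hiB]
      by_cases hfar : (n : ℝ) ≤ ‖ρ i - 1‖
      · have ht := abs_re_term_le hn1 hfar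
        calc (m i : ℝ) * (1 - (1 - 1 / ρ i)⁻¹ ^ n).re
            ≤ (m i : ℝ) * (18 * (n : ℝ) ^ 2 * ((1 + |(ρ i).re|) / (1 + ‖ρ i‖) ^ 2)) :=
              mul_le_mul_of_nonneg_left ((le_abs_self _).trans ht) hm0
          _ = 18 * (n : ℝ) ^ 2 * W i := by simp only [hWdef, weight]; ring
          _ ≤ K * W i := mul_le_mul_of_nonneg_right hK18 (hW0 i)
      · have hnear : ‖ρ i - 1‖ < n := not_le.1 hfar
        have hρn : ‖ρ i‖ < n + 1 := by
          calc ‖ρ i‖ = ‖(ρ i - 1) + 1‖ := by ring_nf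
            _ ≤ ‖ρ i - 1‖ + ‖(1 : ℂ)‖ := norm_add_le _ _
            _ < n + 1 := by rw [norm_one]; linarith
        have hone : (1 : ℝ) ≤ 9 * (n : ℝ) ^ 2 * ((1 + |(ρ i).re|) / (1 + ‖ρ i‖) ^ 2) := by
          rw [mul_div_assoc', one_le_div (by positivity)]
          have hρ0 : 0 ≤ ‖ρ i‖ := norm_nonneg _
          calc (1 + ‖ρ i‖) ^ 2 ≤ (3 * (n : ℝ)) ^ 2 := by
                apply pow_le_pow_left₀ (by positivity)
                linarith
            _ = 9 * (n : ℝ) ^ 2 * 1 := by ring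
            _ ≤ 9 * (n : ℝ) ^ 2 * (1 + |(ρ i).re|) := by
                gcongr; linarith [abs_nonneg (ρ i).re]
        have hterm : (1 - (1 - 1 / ρ i)⁻¹ ^ n).re ≤ 1 + ν ^ n := by
          refine (re_one_sub_pow_le _ n).trans ?_
          have : ‖(1 - 1 / ρ i)⁻¹‖ ≤ ν := hoffB i hiB
          gcongr
        have h1ν : 0 ≤ 1 + ν ^ n := by positivity
        calc (m i : ℝ) * (1 - (1 - 1 / ρ i)⁻¹ ^ n).re ≤ (m i : ℝ) * (1 + ν ^ n) :=
              mul_le_mul_of_nonneg_left hterm hm0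
          _ = (m i : ℝ) * (1 + ν ^ n) * 1 := (mul_one _).symm
          _ ≤ (m i : ℝ) * (1 + ν ^ n) *
                (9 * (n : ℝ) ^ 2 * ((1 + |(ρ i).re|) / (1 + ‖ρ i‖) ^ 2)) :=
              mul_le_mul_of_nonneg_left hone (mul_nonneg hm0 h1ν)
          _ = 9 * (n : ℝ) ^ 2 * (1 + ν ^ n) * W i := by simp only [hWdef, weight]; ring
          _ ≤ K * W i := mul_le_mul_of_nonneg_right hK9 (hW0 i)
  -- Step 8: sum the majorant
  have hfs : Summable f := summable_term hm hR n
  set g₁ : ι → ℝ := fun i ↦ if i ∈ B then (m i : ℝ) * (1 - c * lam ^ n) - K * W i else 0 with hg₁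
  have hg₁s : Summable g₁ :=
    summable_of_ne_finset_zero (s := B) (fun i hi ↦ by simp only [hg₁, if_neg hi])
  have hg₂s : Summable (fun i ↦ K * W i) := hR.mul_left K
  have hgdec : g = fun i ↦ g₁ i + K * W i := by
    funext i
    simp only [hg, hg₁]
    split_ifs <;> ring
  have hgs : Summable g := by rw [hgdec]; exact hg₁s.add hg₂s
  have hg₁sum : ∑' i, g₁ i ≤ MB * (1 - c * lam ^ n) := by
    rw [tsum_eq_sum (s := B) (fun i hi ↦ by simp only [hg₁, if_neg hi]), hMBdef, Finset.sum_mul]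
    refine Finset.sum_le_sum fun i hi ↦ ?_
    simp only [hg₁, if_pos hi]
    nlinarith [hW0 i, hK0]
  have hgsum : ∑' i, g i ≤ MB * (1 - c * lam ^ n) + K * S := by
    rw [hgdec, hg₁s.tsum_add hg₂s, tsum_mul_left]
    exact add_le_add hg₁sum le_rfl
  calc ∑' i, f i ≤ ∑' i, g i := hfs.tsum_le_tsum hfg hgs
    _ ≤ MB * (1 - c * lam ^ n) + K * S := hgsum
    _ = MB + 27 * S * (n : ℝ) ^ 2 + 9 * S * (n : ℝ) ^ 2 * ν ^ n - c * MB * lam ^ n := by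
        rw [hK]; ring
    _ < -K' := by linarith [le_abs_self K', neg_abs_le K']

/-- **Exponents in a residue class.**  If some `Re ρ_{i₀} > 1/2` and every `ρ_i` with `|w_i| > 1`
(`w_i = (1 − 1/ρ_i)⁻¹`) satisfies the PHASE CONDITION `c₀ |w_i|^s ≤ Re(w_i^s)` at `s = |t|` (`c₀ > 0`), then for
every `K'` some exponent `n ≥ 1` with `n ≡ t (mod q)` has Bombieri–Lagarias sum `< −K'`: the returns are taken
along multiples of `q(N+s+1)` (accuracy `c₀/2`) and shifted by `± s`. -/
theorem exists_tsum_lt_modEq (hm : ∀ i, 0 < m i) (h1 : ∀ i, ρ i ≠ 1) (hR : Summable (weight ρ m))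
    {i₀ : ι} (hi₀ : 1 / 2 < (ρ i₀).re) {q : ℕ} (hq : 1 ≤ q) (t : ℤ) {c₀ : ℝ} (hc₀ : 0 < c₀)
    (hphase : ∀ i, 1 < ‖(1 - 1 / ρ i)⁻¹‖ →
      c₀ * ‖(1 - 1 / ρ i)⁻¹‖ ^ t.natAbs ≤ ((1 - 1 / ρ i)⁻¹ ^ t.natAbs).re) (K' : ℝ) :
    ∃ n : ℕ, 1 ≤ n ∧ (n : ℤ) ≡ t [ZMOD q] ∧
      ∑' i, (m i : ℝ) * (1 - (1 - 1 / ρ i)⁻¹ ^ n).re < -K' := by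
  refine exists_tsum_lt_of_returns hm h1 hR hi₀ (half_pos hc₀) (fun n : ℕ ↦ (n : ℤ) ≡ t [ZMOD q]) ?_ K'
  intro B lam hlam1 hB N
  have hlam0 : 0 < lam := zero_lt_one.trans hlam1
  set s : ℕ := t.natAbs with hs
  set z : ι → ℂ := fun i ↦ (1 - 1 / ρ i)⁻¹ / (lam : ℂ) with hz
  have hz1 : ∀ i ∈ B, ‖z i‖ = 1 := fun i hi ↦ by
    simp only [hz]
    rw [norm_div, Complex.norm_real, Real.norm_of_nonneg hlam0.le, hB i hi, div_self hlam0.ne']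
  -- the phase condition on `B`, normalised: `Re(z_i^s) ≥ c₀`
  have hzs : ∀ i ∈ B, c₀ ≤ (z i ^ s).re := by
    intro i hi
    have hwi : ‖(1 - 1 / ρ i)⁻¹‖ = lam := hB i hi
    have hph := hphase i (by rw [hwi]; exact hlam1)
    rw [hwi] at hph
    have hpow : z i ^ s = (((lam ^ s)⁻¹ : ℝ) : ℂ) * (1 - 1 / ρ i)⁻¹ ^ s := by
      simp only [hz]
      rw [div_pow, div_eq_inv_mul, ← Complex.ofReal_pow, ← Complex.ofReal_inv]
    rw [hpow, Complex.re_ofReal_mul]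
    calc c₀ = (lam ^ s)⁻¹ * (c₀ * lam ^ s) := by
          rw [mul_comm c₀, inv_mul_cancel_left₀ (pow_ne_zero s hlam0.ne')]
      _ ≤ (lam ^ s)⁻¹ * ((1 - 1 / ρ i)⁻¹ ^ s).re :=
          mul_le_mul_of_nonneg_left hph (inv_nonneg.2 (pow_nonneg hlam0.le s))
  have hzne : ∀ i ∈ B, z i ≠ 0 := fun i hi h ↦ by
    have := hz1 i hi
    rw [h, norm_zero] at this
    exact zero_ne_one this
  -- returns along multiples of `L = q (N + s + 1)`
  set L : ℕ := q * (N + s + 1) with hL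
  have hLge : N + s + 1 ≤ L := by
    calc N + s + 1 = 1 * (N + s + 1) := (one_mul _).symm
      _ ≤ q * (N + s + 1) := Nat.mul_le_mul_right _ hq
  obtain ⟨d, hd1, hd⟩ := exists_mul_norm_pow_sub_one_lt B z hz1 L (half_pos hc₀)
  have hdL : L ≤ d * L := by
    calc L = 1 * L := (one_mul _).symm
      _ ≤ d * L := Nat.mul_le_mul_right _ hd1
  rcases Int.natAbs_eq t with ht | ht
  · -- `t = s ≥ 0`: exponent `n = dL + s`
    refine ⟨d * L + s, by omega, ?_, fun i hi ↦ ?_⟩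
    · rw [ht, ← hs, Int.modEq_iff_dvd]
      refine ⟨-((d : ℤ) * (N + s + 1)), ?_⟩
      simp only [hL]
      push_cast
      ring
    · show c₀ / 2 ≤ (z i ^ (d * L + s)).re
      rw [pow_add]
      have := sub_lt_re_mul (le_of_eq (by rw [norm_pow, hz1 i hi, one_pow])) (hzs i hi) (hd i hi)
      linarith
  · -- `t = −s < 0`: exponent `n = dL − s`
    have hsd : s ≤ d * L := by omega
    refine ⟨d * L - s, by omega, ?_, fun i hi ↦ ?_⟩
    · rw [ht, ← hs, Int.modEq_iff_dvd, Nat.cast_sub hsd]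
      refine ⟨-((d : ℤ) * (N + s + 1)), ?_⟩
      simp only [hL]
      push_cast
      ring
    · show c₀ / 2 ≤ (z i ^ (d * L - s)).re
      have hzs0 : z i ^ s ≠ 0 := pow_ne_zero _ (hzne i hi)
      have hns : ‖z i ^ s‖ = 1 := by rw [norm_pow, hz1 i hi, one_pow]
      have hmul : z i ^ (d * L - s) = z i ^ (d * L) * (z i ^ s)⁻¹ := by
        rw [eq_mul_inv_iff_mul_eq₀ hzs0, ← pow_add, Nat.sub_add_cancel hsd]
      have hvn : ‖(z i ^ s)⁻¹‖ ≤ 1 := by rw [norm_inv, hns, inv_one]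
      have hvre : c₀ ≤ ((z i ^ s)⁻¹).re := by
        rw [Complex.inv_re, Complex.normSq_eq_norm_sq, hns, one_pow, div_one]
        exact hzs i hi
      rw [hmul]
      have := sub_lt_re_mul hvn hvre (hd i hi)
      linarith

/-- **Bombieri–Lagarias (c)⇒(a) along a residue class, `−n` form.**  Under the phase condition at `s = |t|`
on the `ρ_i` with `|w_i| > 1`: if the sums `Σ' m_i Re[1 − (1 − 1/ρ_i)^{−n}]` are bounded below along
`n ≡ t (mod q)`, `n ≥ 1`, then `Re ρ_i ≤ 1/2` for all `i`. -/
theorem forall_re_le_half_of_bddBelow_modEq (hm : ∀ i, 0 < m i) (h1 : ∀ i, ρ i ≠ 1)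
    (hR : Summable (weight ρ m)) {q : ℕ} (hq : 1 ≤ q) (t : ℤ) {c₀ : ℝ} (hc₀ : 0 < c₀)
    (hphase : ∀ i, 1 < ‖(1 - 1 / ρ i)⁻¹‖ →
      c₀ * ‖(1 - 1 / ρ i)⁻¹‖ ^ t.natAbs ≤ ((1 - 1 / ρ i)⁻¹ ^ t.natAbs).re)
    {K : ℝ} (hK : ∀ n : ℕ, 1 ≤ n → (n : ℤ) ≡ t [ZMOD q] →
      -K ≤ ∑' i, (m i : ℝ) * (1 - (1 - 1 / ρ i)⁻¹ ^ n).re) :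
    ∀ i, (ρ i).re ≤ 1 / 2 := by
  by_contra hneg
  simp only [not_forall, not_le] at hneg
  obtain ⟨i₀, hi₀⟩ := hneg
  obtain ⟨n, hn, hPn, hlt⟩ := exists_tsum_lt_modEq hm h1 hR hi₀ hq t hc₀ hphase K
  exact absurd (hK n hn hPn) (not_le.2 hlt)

/-- **The mirror form with exponent `+n` (Li's side), along a residue class.**  For a family with `ρ_i ≠ 0, 1`
whose reflection `1 − ρ̄_i` satisfies the Bombieri–Lagarias hypothesis, under the phase condition
`c₀ |z_i|^s ≤ Re(z_i^s)` (`z_i = 1 − 1/ρ_i`, `s = |t|`) on the `ρ_i` with `|z_i| > 1`: if Li's sums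
`Σ' m_i Re[1 − (1 − 1/ρ_i)ⁿ]` are bounded below along `n ≡ t (mod q)`, then `Re ρ_i ≥ 1/2` for all `i`. -/
theorem forall_half_le_re_of_bddBelow_modEq (hm : ∀ i, 0 < m i) (h0 : ∀ i, ρ i ≠ 0)
    (h1 : ∀ i, ρ i ≠ 1) (hR : Summable (weight (fun i ↦ 1 - conj (ρ i)) m)) {q : ℕ} (hq : 1 ≤ q)
    (t : ℤ) {c₀ : ℝ} (hc₀ : 0 < c₀)
    (hphase : ∀ i, 1 < ‖1 - 1 / ρ i‖ → c₀ * ‖1 - 1 / ρ i‖ ^ t.natAbs ≤ ((1 - 1 / ρ i) ^ t.natAbs).re)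
    {K : ℝ} (hK : ∀ n : ℕ, 1 ≤ n → (n : ℤ) ≡ t [ZMOD q] →
      -K ≤ ∑' i, (m i : ℝ) * (1 - (1 - 1 / ρ i) ^ n).re) :
    ∀ i, 1 / 2 ≤ (ρ i).re := by
  have h1' : ∀ i, 1 - conj (ρ i) ≠ 1 := by
    intro i h
    apply h0 i
    have : conj (ρ i) = 0 := by linear_combination -h
    simpa using this
  have hw : ∀ i, (1 - 1 / (1 - conj (ρ i)))⁻¹ = conj (1 - 1 / ρ i) := fun i ↦
    inv_one_sub_inv_one_sub_conj (h0 i) (h1 i)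
  have hphase' : ∀ i, 1 < ‖(1 - 1 / (fun i ↦ 1 - conj (ρ i)) i)⁻¹‖ →
      c₀ * ‖(1 - 1 / (fun i ↦ 1 - conj (ρ i)) i)⁻¹‖ ^ t.natAbs ≤
        ((1 - 1 / (fun i ↦ 1 - conj (ρ i)) i)⁻¹ ^ t.natAbs).re := by
    intro i
    simp only [hw i, Complex.norm_conj, ← map_pow, Complex.conj_re]
    exact hphase i
  have hK' : ∀ n : ℕ, 1 ≤ n → (n : ℤ) ≡ t [ZMOD q] →
      -K ≤ ∑' i, (m i : ℝ) * (1 - (1 - 1 / (fun i ↦ 1 - conj (ρ i)) i)⁻¹ ^ n).re := by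
    intro n hn hmod
    have := hK n hn hmod
    rwa [tsum_congr fun i ↦ by rw [re_term_one_sub_conj (h0 i) (h1 i) n]]
  have h := forall_re_le_half_of_bddBelow_modEq (ρ := fun i ↦ 1 - conj (ρ i)) hm h1' hR hq t hc₀
    hphase' hK'
  intro i
  have := h i
  simp only [sub_re, one_re, Complex.conj_re] at this
  linarith

end LiResidueBL

end Summit.RiemannHypothesis.RiemannHypothesis.Theorems.Splittings

end
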